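import Literature.Topology.FourManifolds.BasinPairConj
import Literature.Topology.FourManifolds.MilnorBoxChartMap
import Literature.Topology.FourManifolds.MilnorBoxDynamics
import Literature.Topology.FourManifolds.MilnorBoxReverse
import Literature.Topology.FourManifolds.MorseRearrangement
import HarnessLib

/-!
# Saddle data for a pair of basin settings: Milnor boxes of both fields at the saddles and the
# model conjugations between them

Topic `Literature/Topology/FourManifolds` (support file for the two-field handle-extension
endgame of `stmt-SmoothPoincare4-15190`, after `BasinPairConj.lean`, `MilnorBoxChartMap.lean`).
Everything here is **proved**; the new definitions are bookkeeping structures.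

Milnor, *Lectures on the h-cobordism theorem* (1965), Def. 3.1 (2) (PDF p. 12): about every
critical point a gradient-like field has a chart with `f = f(q) - |x⃗|² + |y⃗|²`, `ξ = (-x⃗, y⃗)`
— a Milnor box `Literature.Topology.FourManifolds.MilnorBox`.  For a pair of basin settings
`P : Literature.Topology.FourManifolds.BasinPair g ξ_A ξ_B` (`BasinPair.lean`: one Morse function
`g` on `(W; ∅, ∂W)`, two gradient-like fields with the same minimum `p₀`) we package the data at
the remaining critical points — the **saddles** `Literature.Topology.FourManifolds.SaddlePt n g`
(critical points of non-zero index):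

* `Literature.Topology.FourManifolds.BasinSetting.X` — the cut-off field whose global flow is
  `B.θ` (`= ξ` on the slab `g⁻¹[lo, hi]`), with `IsFlowOf`, smoothness;
* `Literature.Topology.FourManifolds.BasinPair.SaddleData P` — a common critical value `c` of
  the saddles, Milnor boxes `DA s`, `DB s` of the two cut-off fields at every saddle with a
  common size `ε`, a bijection `σ` of the saddles with matching indices, the `3ε`-balls in the
  interior and between the levels `sph` and `1 - a'`, and pairwise disjoint chart domains;
  `SaddleData.nonempty`: such data exist (with `σ = id` and common charts) when the two fields
  agree near the critical points and the saddles have a common value;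
* the model conjugations `SaddleData.MC s = (DA s).chartMap (DB (σ s))` between corresponding
  boxes and their properties are in `PairSaddlesMC.lean`.

## References

* J. Milnor, *Lectures on the h-cobordism theorem* (1965), Def. 3.1, proofs of Thms. 3.12–3.13
  (PDF pp. 12, 17–19). [MilnorHCobordism1965]
* J. M. Lee, *Introduction to Smooth Manifolds*, 2nd ed. (2012), Prop. 9.13. [LeeSmoothManifolds2013]
-/

open scoped Manifold ContDiff Topology
open Set Function Filter Metric

noncomputable section

namespace Literature.Topology.FourManifolds

open Cobordism FourManifolds.Flow

universe u

/-! ### Two small constructions on Milnor boxes -/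

namespace MilnorBox

variable {m : ℕ} {H : Type*} [TopologicalSpace H] {J : ModelWithCorners ℝ (EuclideanSpace ℝ (Fin m)) H}
  {M : Type u} [TopologicalSpace M] [ChartedSpace H M]
  {f : M → ℝ} {X X' : Π x : M, TangentSpace J x} {q : M}

/-- **The same box for a field equal to the old one on the chart domain.** [folklore] -/
def copyFieldOn (D : MilnorBox J f X q) (h : ∀ x ∈ D.chart.source, X' x = X x) : MilnorBox J f X' q where
  chart := D.chart
  k := D.k
  ε := D.ε
  mem_maximalAtlas := D.mem_maximalAtlas
  mem_source := D.mem_source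
  eps_pos := D.eps_pos
  closedBall_subset := D.closedBall_subset
  apply_eq := D.apply_eq
  mfderiv_eq z hz := by rw [h z hz]; exact D.mfderiv_eq z hz

/-- The copied box has the same chart. [folklore] -/
@[simp] theorem copyFieldOn_chart (D : MilnorBox J f X q) (h : ∀ x ∈ D.chart.source, X' x = X x) :
    (D.copyFieldOn h).chart = D.chart := rfl

/-- The copied box has the same index. [folklore] -/
@[simp] theorem copyFieldOn_k (D : MilnorBox J f X q) (h : ∀ x ∈ D.chart.source, X' x = X x) :
    (D.copyFieldOn h).k = D.k := rfl

/-- The copied box has the same size. [folklore] -/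
@[simp] theorem copyFieldOn_ε (D : MilnorBox J f X q) (h : ∀ x ∈ D.chart.source, X' x = X x) :
    (D.copyFieldOn h).ε = D.ε := rfl

/-- The copied box has the same coordinates. [folklore] -/
@[simp] theorem coord_copyFieldOn (D : MilnorBox J f X q) (h : ∀ x ∈ D.chart.source, X' x = X x) :
    (D.copyFieldOn h).coord = D.coord := rfl

/-- **The same box with a smaller size `ε' ≤ ε`.** [folklore] -/
def shrink (D : MilnorBox J f X q) (ε' : ℝ) (h0 : 0 < ε') (hle : ε' ≤ D.ε) : MilnorBox J f X q where
  chart := D.chart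
  k := D.k
  ε := ε'
  mem_maximalAtlas := D.mem_maximalAtlas
  mem_source := D.mem_source
  eps_pos := h0
  closedBall_subset := (closedBall_subset_closedBall (by linarith)).trans D.closedBall_subset
  apply_eq := D.apply_eq
  mfderiv_eq := D.mfderiv_eq

/-- The shrunk box has the same chart. [folklore] -/
@[simp] theorem shrink_chart (D : MilnorBox J f X q) (ε' : ℝ) (h0 : 0 < ε') (hle : ε' ≤ D.ε) :
    (D.shrink ε' h0 hle).chart = D.chart := rfl

/-- The shrunk box has the same index. [folklore] -/
@[simp] theorem shrink_k (D : MilnorBox J f X q) (ε' : ℝ) (h0 : 0 < ε') (hle : ε' ≤ D.ε) :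
    (D.shrink ε' h0 hle).k = D.k := rfl

/-- The shrunk box has the prescribed size. [folklore] -/
@[simp] theorem shrink_ε (D : MilnorBox J f X q) (ε' : ℝ) (h0 : 0 < ε') (hle : ε' ≤ D.ε) :
    (D.shrink ε' h0 hle).ε = ε' := rfl

/-- The shrunk box has the same coordinates. [folklore] -/
@[simp] theorem coord_shrink (D : MilnorBox J f X q) (ε' : ℝ) (h0 : 0 < ε') (hle : ε' ≤ D.ε) :
    (D.shrink ε' h0 hle).coord = D.coord := rfl

end MilnorBox

/-- **A closed ball of radius `r` lies in the open half-space if the concentric ball of radius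
`2r` lies in the closed half-space** (the range of `𝓡∂ N`). [folklore] -/
theorem closedBall_subset_interior_range_of_subset {N : ℕ} [NeZero N] {u : EuclideanSpace ℝ (Fin N)}
    {r : ℝ} (hr : 0 < r) (h : closedBall u (2 * r) ⊆ range (𝓡∂ N)) :
    closedBall u r ⊆ interior (range (𝓡∂ N)) := by
  rw [interior_range_modelWithCornersEuclideanHalfSpace]
  rw [range_modelWithCornersEuclideanHalfSpace] at h
  intro y hy
  have hv : ‖r • EuclideanSpace.single (0 : Fin N) (1 : ℝ)‖ = r := by
    rw [norm_smul, PiLp.norm_single, norm_one, mul_one, Real.norm_of_nonneg hr.le]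
  have hy' : y - r • EuclideanSpace.single (0 : Fin N) (1 : ℝ) ∈ closedBall u (2 * r) := by
    rw [mem_closedBall] at hy ⊢
    calc dist (y - r • EuclideanSpace.single (0 : Fin N) (1 : ℝ)) u
        ≤ dist (y - r • EuclideanSpace.single (0 : Fin N) (1 : ℝ)) y + dist y u := dist_triangle _ _ _
      _ ≤ r + r := by
          refine add_le_add ?_ hy
          rw [dist_eq_norm, sub_sub_cancel_left, norm_neg, hv]
      _ = 2 * r := by ring
  have h0 := h hy'
  simp only [mem_setOf_eq, PiLp.sub_apply, PiLp.smul_apply, PiLp.single_apply, if_true,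
    smul_eq_mul, mul_one] at h0
  show 0 < y 0
  linarith

/-! ### Saddles and the cut-off field of a basin setting -/

section Setting

variable {n : ℕ} {W : Type u} [TopologicalSpace W] [T2Space W] [SecondCountableTopology W]
  [CompactSpace W] [ChartedSpace (EuclideanHalfSpace (n + 1)) W] [IsManifold (𝓡∂ (n + 1)) ∞ W]

variable (n) in
/-- **The saddles** of `g`: the critical points of non-zero Morse index (for the Morse function of
a basin setting: all critical points but the minimum `p₀`). [cite: MilnorHCobordism1965, Def. 3.1] -/
def SaddlePt (g : W → ℝ) : Type u :=
  {q : W // IsMCriticalPt (𝓡∂ (n + 1)) g q ∧ morseIndex (𝓡∂ (n + 1)) g q ≠ 0}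

namespace BasinSetting

variable {g : W → ℝ} {ξ : Π x : W, TangentSpace (𝓡∂ (n + 1)) x} (B : BasinSetting g ξ)

/-- **The cut-off field** of the setting, whose global flow is `B.θ`. [cite: MilnorHCobordism1965, §4 (PDF pp. 21–25)] -/
def X : Π x : W, TangentSpace (𝓡∂ (n + 1)) x :=
  slabField (c := Cobordism.ofBoundary n W) g ξ B.lo B.hi

/-- The cut-off field, unfolded. [folklore] -/
theorem X_apply (x : W) : B.X x = slabField (c := Cobordism.ofBoundary n W) g ξ B.lo B.hi x := rfl

/-- `θ` is the flow of the cut-off field (stated eta-expanded). [cite: LeeSmoothManifolds2013, Thm. 9.12] -/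
theorem isFlowOf_X : IsFlowOf (𝓡∂ (n + 1)) (fun x : W => B.X x) B.θ := B.isSmoothFlow.isFlowOf

/-- `θ` is a smooth flow of the cut-off field (stated eta-expanded). [cite: LeeSmoothManifolds2013, Thm. 9.12] -/
theorem isSmoothFlow_X : IsSmoothFlow (𝓡∂ (n + 1)) (fun x : W => B.X x) B.θ := B.isSmoothFlow

/-- The cut-off field is smooth. [folklore] -/
theorem contMDiff_X : ContMDiff (𝓡∂ (n + 1)) (𝓡∂ (n + 1)).tangent ∞
    fun x : W => (⟨x, B.X x⟩ : TangentBundle (𝓡∂ (n + 1)) W) :=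
  B.preSlabFlow.contMDiff_slabField

/-- The cut-off field is `C¹`. [folklore] -/
theorem contMDiff_X_one : ContMDiff (𝓡∂ (n + 1)) (𝓡∂ (n + 1)).tangent 1
    fun x : W => (⟨x, B.X x⟩ : TangentBundle (𝓡∂ (n + 1)) W) :=
  B.contMDiff_X.of_le (by norm_cast)

/-- On the slab the cut-off field is `ξ`. [folklore] -/
theorem X_eq {x : W} (hx : g x ∈ Icc B.lo B.hi) : B.X x = ξ x := B.preSlabFlow.slabField_eq hx

/-- A saddle is not the minimum. [folklore] -/
theorem coe_ne_p₀ (s : SaddlePt n g) : s.1 ≠ B.p₀ := fun h =>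
  s.2.2 (by have := B.p₀_mem_criticalSetOfIndex; rw [← h] at this; exact this.2)

/-- A critical point other than the minimum is a saddle. [folklore] -/
theorem morseIndex_ne_zero {q : W} (hq : IsMCriticalPt (𝓡∂ (n + 1)) g q) (hne : q ≠ B.p₀) :
    morseIndex (𝓡∂ (n + 1)) g q ≠ 0 := fun h0 =>
  hne (B.eq_p₀_of_morseIndex_eq_zero hq h0)

/-- The saddles lie above the chart sphere: `sph < g s`. [folklore] -/
theorem sph_lt_apply_saddle (s : SaddlePt n g) : B.sph < g s.1 :=
  B.lt_of_isMCriticalPt s.1 s.2.1 (B.coe_ne_p₀ s)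

/-- The saddles lie below the collar: `g s < 1 - a'`. [folklore] -/
theorem apply_saddle_lt (s : SaddlePt n g) : g s.1 < 1 - B.S.a' := B.crit_lt s.1 s.2.1

/-- The saddles lie in the open slab `(lo, hi)`. [folklore] -/
theorem apply_saddle_mem_Ioo (s : SaddlePt n g) : g s.1 ∈ Ioo B.lo B.hi :=
  ⟨B.lo_lt_apply s.1, (B.apply_saddle_lt s).trans (B.one_sub_a'_lt_L.trans B.L_lt_hi)⟩

include B in
/-- The saddles are interior points. [cite: MilnorHCobordism1965, Def. 2.3] -/
theorem isInteriorPoint_saddle (s : SaddlePt n g) : (𝓡∂ (n + 1)).IsInteriorPoint s.1 :=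
  B.isMorseAdapted.isInteriorPoint_of_isMCriticalPt s.2.1

include B in
/-- **There are finitely many saddles.** [cite: MilnorHCobordism1965, §2 (PDF p. 5)] -/
theorem finite_saddlePt : Finite (SaddlePt n g) := by
  have h : (criticalSet (𝓡∂ (n + 1)) g : Set W).Finite := B.isMorseFunction.finite_criticalSet
  have h2 : ({q : W | IsMCriticalPt (𝓡∂ (n + 1)) g q ∧ morseIndex (𝓡∂ (n + 1)) g q ≠ 0}).Finite :=
    h.subset fun q hq => hq.1
  exact h2.to_subtype

end BasinSetting

/-! ### Saddle data of a pair -/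

namespace BasinPair

variable {g : W → ℝ} {ξA ξB : Π x : W, TangentSpace (𝓡∂ (n + 1)) x} (P : BasinPair g ξA ξB)

/-- **Saddle data** of a pair of basin settings: a common saddle value, Milnor boxes of the two
cut-off fields at the saddles with a common size, a bijection of the saddles with matching
indices, room between the chart sphere and the collar, interiority of the `3ε`-balls, and
pairwise disjoint chart domains. [cite: MilnorHCobordism1965, Def. 3.1 (2) (PDF p. 12), Thm. 4.1] -/
structure SaddleData where
  /-- the common critical value of the saddles -/
  c : ℝ
  /-- every saddle has the value `c` -/
  apply_eq_c : ∀ s : SaddlePt n g, g s.1 = c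
  /-- the common size of the boxes -/
  ε : ℝ
  /-- the size is positive -/
  ε_pos : 0 < ε
  /-- the boxes of the cut-off field of `A` -/
  DA : ∀ s : SaddlePt n g, MilnorBox (𝓡∂ (n + 1)) g P.A.X s.1
  /-- the boxes of the cut-off field of `B` -/
  DB : ∀ s : SaddlePt n g, MilnorBox (𝓡∂ (n + 1)) g P.B.X s.1
  /-- the `A`-boxes have size `ε` -/
  εA : ∀ s, (DA s).ε = ε
  /-- the `B`-boxes have size `ε` -/
  εB : ∀ s, (DB s).ε = ε
  /-- the correspondence of the saddles -/
  σ : SaddlePt n g ≃ SaddlePt n g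
  /-- corresponding boxes have the same index -/
  k_eq : ∀ s, (DB (σ s)).k = (DA s).k
  /-- room below: the `3ε`-balls lie above the chart sphere -/
  sph_lt : P.A.sph < c - 9 * ε ^ 2
  /-- room above: the `3ε`-balls lie below the collar -/
  lt_collar : c + 9 * ε ^ 2 < 1 - P.A.S.a'
  /-- the `3ε`-balls of the `A`-boxes lie in the open half-space -/
  intA : ∀ s, closedBall (DA s).center (3 * ε) ⊆ interior (range (𝓡∂ (n + 1)))
  /-- the `3ε`-balls of the `B`-boxes lie in the open half-space -/
  intB : ∀ s, closedBall (DB s).center (3 * ε) ⊆ interior (range (𝓡∂ (n + 1)))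
  /-- the chart domains of the `A`-boxes are pairwise disjoint -/
  disjA : ∀ s s', s ≠ s' → Disjoint (DA s).chart.source (DA s').chart.source
  /-- the chart domains of the `B`-boxes are pairwise disjoint -/
  disjB : ∀ s s', s ≠ s' → Disjoint (DB s).chart.source (DB s').chart.source

/-! ### Existence -/

/-- **Saddle data exist** when the two fields agree near the critical points and the saddles
have a common value `c` between the chart sphere and the collar: Milnor boxes inside the open
slab, inside the set where the fields agree and inside pairwise disjoint neighbourhoods of the
(finitely many) saddles, shrunk to a common size. [cite: MilnorHCobordism1965, Def. 3.1 (2) (PDF p. 12)] -/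
theorem SaddleData.nonempty (heq : ∀ p, IsMCriticalPt (𝓡∂ (n + 1)) g p → ∀ᶠ x in 𝓝 p, ξA x = ξB x)
    {c : ℝ} (hc : ∀ s : SaddlePt n g, g s.1 = c) (hsph : P.A.sph < c) (hcol : c < 1 - P.A.S.a') :
    Nonempty P.SaddleData := by
  classical
  have hfin : Finite (SaddlePt n g) := P.A.finite_saddlePt
  have hgc : Continuous g := P.A.isMorseFunction.isMorse.contMDiff.continuous
  -- disjoint neighbourhoods of the saddles
  obtain ⟨U, hU, hUd⟩ := (Set.finite_range (fun s : SaddlePt n g => s.1)).t2_separation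
  have hdisjU : ∀ s s' : SaddlePt n g, s ≠ s' → Disjoint (U s.1) (U s'.1) := fun s s' hne =>
    hUd (mem_range_self s) (mem_range_self s') (fun h => hne (Subtype.ext h))
  -- the open sets carrying the boxes
  set O : SaddlePt n g → Set W := fun s =>
    g ⁻¹' Ioo P.A.lo P.A.hi ∩ interior {x | ξA x = ξB x} ∩ U s.1 with hO
  have hOo : ∀ s, IsOpen (O s) := fun s =>
    ((isOpen_Ioo.preimage hgc).inter isOpen_interior).inter (hU s.1).2
  have hsO : ∀ s : SaddlePt n g, s.1 ∈ O s := fun s =>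
    ⟨⟨P.A.apply_saddle_mem_Ioo s, mem_interior_iff_mem_nhds.2 (heq s.1 s.2.1)⟩, (hU s.1).1⟩
  have hXA : ∀ s, ∀ x ∈ O s, P.A.X x = ξA x := fun s x hx =>
    P.A.X_eq (Ioo_subset_Icc_self hx.1.1)
  have hbox : ∀ s : SaddlePt n g, ∃ D : MilnorBox (𝓡∂ (n + 1)) g P.A.X s.1, D.chart.source ⊆ O s :=
    fun s => P.A.isGradientLike.exists_milnorBox_source_subset s.2.1 (P.A.isInteriorPoint_saddle s)
      (hOo s) (hsO s) (hXA s)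
  choose D hD using hbox
  -- the `B`-field equals the `A`-field on the chart domains
  have hXB : ∀ s, ∀ x ∈ (D s).chart.source, P.B.X x = P.A.X x := fun s x hx => by
    have hx' := hD s hx
    have h1 : g x ∈ Icc P.B.lo P.B.hi := by
      rw [P.lo_eq, P.hi_eq]; exact Ioo_subset_Icc_self hx'.1.1
    have h2 : ξA x = ξB x := interior_subset (s := {x | ξA x = ξB x}) hx'.1.2
    rw [P.B.X_eq h1, hXA s x hx', h2]
  -- a common size
  obtain ⟨ε₁, hε₁0, hε₁⟩ : ∃ ε₁ : ℝ, 0 < ε₁ ∧ ∀ s, ε₁ ≤ (D s).ε := by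
    rcases isEmpty_or_nonempty (SaddlePt n g) with h | h
    · exact ⟨1, one_pos, fun s => isEmptyElim s⟩
    · obtain ⟨s₀, hs₀⟩ := Finite.exists_min fun s : SaddlePt n g => (D s).ε
      exact ⟨(D s₀).ε, (D s₀).eps_pos, hs₀⟩
  set d : ℝ := min (c - P.A.sph) (1 - P.A.S.a' - c) with hd
  have hd0 : 0 < d := lt_min (by linarith) (by linarith)
  set ε : ℝ := min (ε₁ / 2) (min 1 (d / 10)) with hε
  have hε0 : 0 < ε := lt_min (by linarith) (lt_min one_pos (by linarith))
  have hεε₁ : ε ≤ ε₁ / 2 := min_le_left _ _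
  have hε1 : ε ≤ 1 := (min_le_right _ _).trans (min_le_left _ _)
  have hεd : ε ≤ d / 10 := (min_le_right _ _).trans (min_le_right _ _)
  have h9 : 9 * ε ^ 2 < d := by nlinarith
  have hdle₁ : d ≤ c - P.A.sph := min_le_left _ _
  have hdle₂ : d ≤ 1 - P.A.S.a' - c := min_le_right _ _
  have hle : ∀ s, ε ≤ (D s).ε := fun s => by linarith [hε₁ s]
  -- the boxes
  set DA : ∀ s : SaddlePt n g, MilnorBox (𝓡∂ (n + 1)) g P.A.X s.1 := fun s => (D s).shrink ε hε0 (hle s)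
    with hDA
  set DB : ∀ s : SaddlePt n g, MilnorBox (𝓡∂ (n + 1)) g P.B.X s.1 := fun s => (DA s).copyFieldOn (hXB s)
    with hDB
  -- interiority of the `3ε`-balls
  have hint : ∀ s, closedBall (DA s).center (3 * ε) ⊆ interior (range (𝓡∂ (n + 1))) := fun s => by
    refine closedBall_subset_interior_range_of_subset (by linarith) ?_
    have h1 : closedBall (DA s).center (2 * (3 * ε)) ⊆ closedBall ((D s).chart.extend (𝓡∂ (n + 1)) s.1)
        (3 * (D s).ε) := closedBall_subset_closedBall (by linarith [hε₁ s])
    exact (h1.trans (D s).closedBall_subset).trans ((D s).chart.extend_target_subset_range (I := 𝓡∂ (n + 1)))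
  have hdisj : ∀ s s' : SaddlePt n g, s ≠ s' → Disjoint (DA s).chart.source (DA s').chart.source :=
    fun s s' hne => (hdisjU s s' hne).mono ((hD s).trans inter_subset_right) ((hD s').trans inter_subset_right)
  exact ⟨⟨c, hc, ε, hε0, DA, DB, fun s => rfl, fun s => rfl, Equiv.refl _, fun s => rfl, by linarith,
    by linarith, hint, hint, hdisj, hdisj⟩⟩

end BasinPair

end Setting

end Literature.Topology.FourManifolds
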